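import Literature.Analysis.FunctionSpaces.LittlewoodPaleyHolderDirect
import HarnessLib

/-!
# The commutator of a Littlewood–Paley block with a Lipschitz multiplier

Analysis/FunctionSpaces support file (serves the discharge of the named fact
`Literature.Analysis.FluidPDE.cheskidov_dai_occupation_regular` — Cheskidov–Dai's low-mode regularity
criterion, arXiv:1507.06611 = Proc. Edinburgh Math. Soc. (2025), Thm. 1.1 — whose proof controls the
low–high paraproduct of the nonlinear term through the commutator `[Δ_q, u_{≤p-2}·∇] u_p`, estimate
(3.5) of the paper: "by Young's inequality,
`‖[Δ_q, u_{≤p-2}·∇] u_q‖_{r₁} ≲ ‖u_q‖_{r₃} ∑_{p' ≤ p-2} λ_{p'} ‖u_{p'}‖_{r₂}`", the point being that the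
derivative lands on the LOW-frequency factor; Bahouri–Chemin–Danchin, Lemma 2.97, is the general form).

For the real block `Δ̇_j v = K_j ⋆ v` of `LittlewoodPaleyKernel.lean` (`blockFn j`) on a finite-dimensional
inner product space `E`, a scalar multiplier `f : E → ℝ` which is bounded, continuous and `L`-Lipschitz,
and a bounded field `g ∈ L^p(E; E')`, `1 ≤ p`, everything here is **proved**:

* `lintegral_enorm_blockKernel_eq_zero_scale` — the `L¹` mass of the kernel, `∫⁻ |K_j| = ∫⁻ |K₀|`, so that
  the Young bounds of `LittlewoodPaleyKernel.lean` are uniform in `j`;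
* `blockFn_smul_sub_smul_blockFn_apply` — the commutator is an honest integral:
  `(Δ̇_j (f g) - f Δ̇_j g)(x) = ∫ (K_j(t) (f(x - t) - f(x))) • g(x - t) dt`;
* `norm_blockFn_smul_sub_smul_blockFn_le` — pointwise,
  `‖(Δ̇_j (f g) - f Δ̇_j g)(x)‖ ≤ L ∫ |K_j(t)| ‖t‖ ‖g(x - t)‖ dt` (`|f(x-t) - f(x)| ≤ L ‖t‖`);
* `eLpNorm_blockFn_smul_sub_smul_blockFn_le` — **the commutator estimate**: by Young's inequality and
  the dyadic scaling of the first moment of the kernel (tree: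
  `integral_norm_blockKernel_mul_norm_rpow`, `∫ |K_j(t)| ‖t‖ dt = 2^{-j} ∫ |K₀(z)| ‖z‖ dz`),
  `‖Δ̇_j (f g) - f Δ̇_j g‖_{L^p} ≤ L · 2^{-j} (∫ |K₀(z)| ‖z‖ dz) · ‖g‖_{L^p}`.

The boundedness of `g` is only used qualitatively (integrability of the majorant); the bound does not
see it. Not here: the version with the derivative inside (`[Δ̇_j, f] ∂g`, which follows with Bernstein when
`g` is a block), vector-valued multipliers (apply componentwise), the torus.

## Mathlib / tree search

Mathlib (this pin): no commutator estimates for convolution operators (`Mathlib/Analysis/Convolution.lean`).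
Tree: `blockFn`, `integrable_blockKernel_smul_sub`, Young `eLpNorm_convolution_smul_le`
(`LittlewoodPaleyKernel`, `LittlewoodPaleyBernsteinProofs`), the kernel moments
`integrable_norm_blockKernel_mul_norm_rpow` / `integral_norm_blockKernel_mul_norm_rpow`
(`LittlewoodPaleyHolderDirect`); the tree's commutator files are on the torus and of a different kind
(`SobolevCommutatorL1`: DiPerna–Lions mollification; `TorusCommutatorEstimate`: Constantin–E–Titi).

## References

* A. Cheskidov, M. Dai, *Regularity criteria for the 3D Navier–Stokes and MHD equations*,
  arXiv:1507.06611 = Proc. Edinburgh Math. Soc. (2025), §3.1, estimate (3.5). [CheskidovDai2015]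
* H. Bahouri, J.-Y. Chemin, R. Danchin, *Fourier Analysis and Nonlinear PDE*, Springer 2011,
  Lemma 2.97 (commutator of `Δ̇_j` with a multiplier). [BahouriCheminDanchin2011]
-/

noncomputable section

open MeasureTheory Filter Function
open scoped ENNReal NNReal Convolution

namespace Literature.Analysis.FunctionSpaces

variable {E : Type*} [NormedAddCommGroup E] [InnerProductSpace ℝ E] [FiniteDimensional ℝ E]
  [MeasurableSpace E] [BorelSpace E]
variable {E' : Type*} [NormedAddCommGroup E'] [NormedSpace ℝ E']

/-! ## The first moment of the kernel -/

/-- The first-moment weight `t ↦ |K_j(t)| ‖t‖` of the real Littlewood–Paley kernel is integrable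
(the case `s = 1` of the tree's `integrable_norm_blockKernel_mul_norm_rpow`). [folklore] -/
private theorem integrable_norm_blockKernel_mul_norm (j : ℤ) :
    Integrable (fun t : E => ‖blockKernel E j t‖ * ‖t‖) (volume : Measure E) := by
  refine (integrable_norm_blockKernel_mul_norm_rpow (E := E) j zero_le_one).congr
    (Eventually.of_forall fun t => ?_)
  simp only [Real.rpow_one]

/-- **Dyadic scaling of the first moment**: `∫ |K_j(t)| ‖t‖ dt = 2^{-j} ∫ |K₀(z)| ‖z‖ dz` (the case
`s = 1` of the tree's `integral_norm_blockKernel_mul_norm_rpow`). [folklore] -/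
private theorem integral_norm_blockKernel_mul_norm (j : ℤ) :
    ∫ t : E, ‖blockKernel E j t‖ * ‖t‖ = (2 : ℝ) ^ (-(j : ℝ)) * ∫ z : E, ‖blockKernel E 0 z‖ * ‖z‖ := by
  have h := integral_norm_blockKernel_mul_norm_rpow (E := E) j 1
  simp only [Real.rpow_one, mul_one] at h
  exact h

/-- The first moment as a lower Lebesgue integral:
`∫⁻ ‖|K_j(t)| ‖t‖‖ₑ dt = ofReal (2^{-j} ∫ |K₀(z)| ‖z‖ dz)`. [folklore] -/
private theorem lintegral_enorm_norm_blockKernel_mul_norm (j : ℤ) :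
    ∫⁻ t : E, ‖(‖blockKernel E j t‖ * ‖t‖)‖ₑ =
      ENNReal.ofReal ((2 : ℝ) ^ (-(j : ℝ)) * ∫ z : E, ‖blockKernel E 0 z‖ * ‖z‖) := by
  rw [← integral_norm_blockKernel_mul_norm j,
    ofReal_integral_eq_lintegral_ofReal (integrable_norm_blockKernel_mul_norm j)
      (Eventually.of_forall fun t => by positivity)]
  refine lintegral_congr fun t => ?_
  rw [Real.enorm_eq_ofReal (by positivity)]

/-- **The `L¹` mass of the kernel is scale invariant**: `∫⁻ |K_j| = ∫⁻ |K₀|` (the case `s = 0` of the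
tree's `integral_norm_blockKernel_mul_norm_rpow`; the same statement is
`Literature.Analysis.FluidPDE.lintegral_enorm_blockKernel` of `OseenKernelBlocks.lean`, re-derived here to keep
the imports of the Littlewood–Paley files light). It makes the Young bounds `‖Δ̇_j f‖_{L^p} ≤ ∫⁻|K_j| ‖f‖_{L^p}`
(`eLpNorm_blockFn_le`) uniform in `j` (BCD §2.2, proof of Lemma 2.1: `‖𝓕⁻¹φ(2^{-j}·)‖_{L¹} = ‖𝓕⁻¹φ‖_{L¹}`).
[cite: BahouriCheminDanchin2011, Lemma 2.1 (proof)] -/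
theorem lintegral_enorm_blockKernel_eq_zero_scale (j : ℤ) :
    ∫⁻ t : E, ‖blockKernel E j t‖ₑ = ∫⁻ z : E, ‖blockKernel E 0 z‖ₑ := by
  have h := integral_norm_blockKernel_mul_norm_rpow (E := E) j 0
  simp only [Real.rpow_zero, mul_one, mul_zero, Real.rpow_zero, one_mul] at h
  rw [← ofReal_integral_norm_eq_lintegral_enorm (integrable_blockKernel j),
    ← ofReal_integral_norm_eq_lintegral_enorm (integrable_blockKernel 0), h]

/-! ## The commutator -/

section Commutator

variable {f : E → ℝ} {g : E → E'} {L M G : ℝ} {p : ℝ≥0∞}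

/-- A bounded continuous multiplier keeps a field in `L^p`: `‖f‖ ≤ M`, `g ∈ L^p ⇒ f g ∈ L^p`. [folklore] -/
private theorem memLp_smul_of_bound (hfc : Continuous f) (hfM : ∀ x, ‖f x‖ ≤ M) (hg : MemLp g p volume) :
    MemLp (fun y => f y • g y) p volume := by
  refine MemLp.of_le_mul (c := M) hg (hfc.aestronglyMeasurable.smul hg.1) (Eventually.of_forall fun y => ?_)
  rw [norm_smul]
  exact mul_le_mul_of_nonneg_right (hfM y) (norm_nonneg _)

/-- **The commutator is an integral**: for `f` bounded continuous and `g ∈ L^p` (`1 ≤ p`),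
`(Δ̇_j (f g))(x) - f(x) (Δ̇_j g)(x) = ∫ (K_j(t) (f(x - t) - f(x))) • g(x - t) dt` (Cheskidov–Dai §3.1, the
display before (3.5): "By definition of `Δ_q`,
`[Δ_q, u_{≤p-2}·∇]u_q = λ_q³ ∫ h(λ_q(x-y)) (u_{≤p-2}(y) - u_{≤p-2}(x)) ∇u_q(y) dy`").
[cite: CheskidovDai2015, §3.1 (display before (3.5))] -/
theorem blockFn_smul_sub_smul_blockFn_apply (j : ℤ) [Fact (1 ≤ p)] (hfc : Continuous f)
    (hfM : ∀ x, ‖f x‖ ≤ M) (hg : MemLp g p volume) (x : E) :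
    blockFn j (fun y => f y • g y) x - f x • blockFn j g x =
      ∫ t, (blockKernel E j t * (f (x - t) - f x)) • g (x - t) := by
  have h1 : Integrable (fun t => blockKernel E j t • (f (x - t) • g (x - t))) (volume : Measure E) :=
    integrable_blockKernel_smul_sub j (memLp_smul_of_bound hfc hfM hg) x
  have h2 : Integrable (fun t => f x • (blockKernel E j t • g (x - t))) (volume : Measure E) :=
    (integrable_blockKernel_smul_sub j hg x).smul (f x)
  rw [blockFn_apply, blockFn_apply, ← integral_smul, ← integral_sub h1 h2]
  refine integral_congr_ae (Eventually.of_forall fun t => ?_)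
  simp only [mul_smul, sub_smul, smul_sub, smul_comm (f x) (blockKernel E j t)]

/-- **Pointwise bound on the commutator**: if moreover `f` is `L`-Lipschitz and `g` is bounded, then
`‖(Δ̇_j (f g) - f Δ̇_j g)(x)‖ ≤ L ∫ |K_j(t)| ‖t‖ ‖g(x - t)‖ dt` (`|f(x-t) - f(x)| ≤ L‖t‖`; the integral
on the right is the convolution of the first-moment weight with `‖g‖`). [cite: CheskidovDai2015, §3.1 (3.5)] -/
theorem norm_blockFn_smul_sub_smul_blockFn_le (j : ℤ) [Fact (1 ≤ p)] (hfc : Continuous f)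
    (hfM : ∀ x, ‖f x‖ ≤ M) (hfL : ∀ x y, ‖f x - f y‖ ≤ L * ‖x - y‖)
    (hg : MemLp g p volume) (hgG : ∀ y, ‖g y‖ ≤ G) (x : E) :
    ‖blockFn j (fun y => f y • g y) x - f x • blockFn j g x‖ ≤
      L * ∫ t, (‖blockKernel E j t‖ * ‖t‖) * ‖g (x - t)‖ := by
  rw [blockFn_smul_sub_smul_blockFn_apply j hfc hfM hg x]
  have hmaj : Integrable (fun t : E => (‖blockKernel E j t‖ * ‖t‖) * ‖g (x - t)‖) (volume : Measure E) := by
    refine (integrable_norm_blockKernel_mul_norm j).mul_of_top_left ?_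
    exact memLp_top_of_bound (hg.1.norm.comp_measurePreserving (Measure.measurePreserving_sub_left volume x))
      G (Eventually.of_forall fun t => by simpa using hgG (x - t))
  refine (norm_integral_le_integral_norm _).trans ?_
  rw [← integral_const_mul]
  refine integral_mono_of_nonneg (Eventually.of_forall fun t => norm_nonneg _) (hmaj.const_mul L)
    (Eventually.of_forall fun t => ?_)
  simp only
  rw [norm_smul, norm_mul]
  have hft : ‖f (x - t) - f x‖ ≤ L * ‖t‖ := by
    have := hfL (x - t) x
    rwa [sub_sub_cancel_left, norm_neg] at this
  calc ‖blockKernel E j t‖ * ‖f (x - t) - f x‖ * ‖g (x - t)‖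
      ≤ ‖blockKernel E j t‖ * (L * ‖t‖) * ‖g (x - t)‖ := by gcongr
    _ = L * ((‖blockKernel E j t‖ * ‖t‖) * ‖g (x - t)‖) := by ring

/-- **The commutator estimate** (Cheskidov–Dai (3.5); Bahouri–Chemin–Danchin Lemma 2.97): for a bounded,
continuous, `L`-Lipschitz multiplier `f : E → ℝ` (`0 ≤ L`) and a bounded field `g ∈ L^p(E; E')`, `1 ≤ p`,
`‖Δ̇_j (f g) - f Δ̇_j g‖_{L^p} ≤ L · 2^{-j} (∫ |K₀(z)| ‖z‖ dz) · ‖g‖_{L^p}` — Young's inequality for the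
convolution of the first-moment weight `|K_j(t)| ‖t‖` (of mass `2^{-j} ∫ |K₀| ‖·‖`) with `‖g‖`. The gain
`2^{-j}` against the Lipschitz constant of the LOW-frequency factor is what makes the low–high paraproduct
linear in `∑_{p'} λ_{p'} ‖u_{p'}‖_∞`. [cite: CheskidovDai2015, §3.1 (3.5)] -/
theorem eLpNorm_blockFn_smul_sub_smul_blockFn_le (j : ℤ) (hp : 1 ≤ p) (hfc : Continuous f)
    (hfM : ∀ x, ‖f x‖ ≤ M) (hfL : ∀ x y, ‖f x - f y‖ ≤ L * ‖x - y‖) (hL : 0 ≤ L)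
    (hg : MemLp g p volume) (hgG : ∀ y, ‖g y‖ ≤ G) :
    eLpNorm (fun x => blockFn j (fun y => f y • g y) x - f x • blockFn j g x) p volume ≤
      ENNReal.ofReal L * ENNReal.ofReal ((2 : ℝ) ^ (-(j : ℝ)) * ∫ z : E, ‖blockKernel E 0 z‖ * ‖z‖) *
        eLpNorm g p volume := by
  haveI : Fact (1 ≤ p) := ⟨hp⟩
  set m : E → ℝ := fun t => ‖blockKernel E j t‖ * ‖t‖ with hm
  set N : E → ℝ := m ⋆[ContinuousLinearMap.lsmul ℝ ℝ, volume] (fun y => ‖g y‖) with hN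
  -- pointwise domination by `L · N`
  have hptw : ∀ x, ‖blockFn j (fun y => f y • g y) x - f x • blockFn j g x‖ ≤ ‖(L • N) x‖ := by
    intro x
    have h := norm_blockFn_smul_sub_smul_blockFn_le j hfc hfM hfL hg hgG x
    have hN' : N x = ∫ t, (‖blockKernel E j t‖ * ‖t‖) * ‖g (x - t)‖ := by
      rw [hN, convolution_lsmul]; rfl
    have hN0 : 0 ≤ N x := by
      rw [hN']
      exact integral_nonneg fun t => by positivity
    rw [Pi.smul_apply, smul_eq_mul, Real.norm_of_nonneg (mul_nonneg hL hN0), hN']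
    exact h
  -- Young for `N`
  have hYoung : eLpNorm N p volume ≤ (∫⁻ t, ‖m t‖ₑ) * eLpNorm (fun y => ‖g y‖) p volume :=
    eLpNorm_convolution_smul_le ((continuous_blockKernel j).norm.mul continuous_norm).aestronglyMeasurable
      hg.1.norm hp
  calc eLpNorm (fun x => blockFn j (fun y => f y • g y) x - f x • blockFn j g x) p volume
      ≤ eLpNorm (L • N) p volume := eLpNorm_mono hptw
    _ = ‖L‖ₑ * eLpNorm N p volume := eLpNorm_const_smul L N p volume
    _ ≤ ‖L‖ₑ * ((∫⁻ t, ‖m t‖ₑ) * eLpNorm (fun y => ‖g y‖) p volume) := by gcongr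
    _ = ENNReal.ofReal L * ENNReal.ofReal ((2 : ℝ) ^ (-(j : ℝ)) * ∫ z : E, ‖blockKernel E 0 z‖ * ‖z‖) *
        eLpNorm g p volume := by
        rw [hm, lintegral_enorm_norm_blockKernel_mul_norm j, eLpNorm_norm, Real.enorm_eq_ofReal hL, mul_assoc]

end Commutator

end Literature.Analysis.FunctionSpaces

end
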